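/-
Copyright: public-domain mathematics; typed transcription for the H21 Literature library (cell lit-balaban,
writer seat p40 gen 12 = literature-prover-lit-balaban-p40-g12-0).

statement-level skeleton of published theorems with citation tags; proofs where landed; nothing here is a claim about the Yang–Mills mass gap

# Bałaban, *Propagators for lattice gauge theories in a background field*, Commun. Math. Phys. **99** (1985)
# 389–434 — (3.18) p. 393: the multi-level cube geometry 𝔅 = ⋃_j Λ_j PLACED INSIDE the lattice T_η as the block
# system of Ω₁, and the Dirichlet-(3.25) statements of `B9Eq318DirichletBlocks` for it.

THE PRINTED SENTENCES ([B9] p. 393, verbatim, as quoted in `B9BlockSystemSigma`): «Now let us define a sequence of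
domains Ω_j ⊂ T^{(j)}, j = 1, …, k, such that Ω_j ⊃ B(Ω_{j+1}) … Next we define Λ_j = Ω_j^{(j)}∖Ω_{j+1}^{(j)},
j = 0,1,…,k, Ω_{k+1} = ∅, or Ω_j∖Ω_{j+1} = B^j(Λ_j), hence Λ_j ⊂ T^{(j)}_{L^jη}.»; «where Q′λ is defined on
𝔅 = ⋃_{j=0}^{k} Λ_j by the formulas (Q′λ)(y) = (Q′_j(U)λ)(y) for y∈Λ_j, (3.18)».

WHY THIS FILE.  `B9Eq318DirichletBlocks` (p40 gen 12) takes the blocks of Ω₁ ⊂ T_η as an abstract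
`B9Thm311Lattice.IsBlockSystem` ON THE CARRIER ↥Ω₁ (for the bonds of T_η inside Ω₁), adds the 0-blocks of (3.18) and
proves Thm 3.11 «obvious» and the Ω₀-independence of R for the resulting Q′.  The cell's model of the printed
multi-level cube geometry, `B9BlockSystemSigma.isBlockSystem_levels`, lives on its own carrier `LSite d M l` (a
disjoint union over the levels j of M_j^d cubes of side l_j + 1), with «the geometric placement of the regions Λ_j
inside one torus T_η … NOT asserted» (its header).  This file supplies the placement step in the only form the
algebra needs: a block system is transported along any bijection of sites (`isBlockSystem_equiv`), so any
EMBEDDING of a finite lattice X into T_η whose bonds go to bonds of T_η turns a block system on X into one on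
Ω₁ := its image (`isBlockSystem_embed`); for X = the multi-level cube geometry this gives the printed Ω₁-blocks
inside T_η (`isBlockSystem_levels_embed`), and the statements of `B9Eq318DirichletBlocks` §3 follow for them with
purely geometric hypotheses (`exists_data_levels`, `R325_dirichlet_indep_levels`).

CONTENT.
* §1 `eqvW`/`eqvB`/`eqvΓ`/`eqvY` (transport of weights, blocks, contours, centres along ε : X ≃ X₂);
  **`isBlockSystem_equiv`** (for any bond set of X₂ containing the ε-images of the bonds of X).
* §2 `embΩ emb` = the image of an embedding emb : X ↪ T_η as a `Finset` (the set Ω₁), `embEquiv` : X ≃ ↥(embΩ emb);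
  **`isBlockSystem_embed`**: a block system on X becomes one on ↥Ω₁ for `intBonds Ω₁ bonds` as soon as emb maps
  the bonds of X to bonds of T_η.
* §3 the multi-level cube geometry: **`isBlockSystem_levels_embed`**, **`exists_data_levels`** (Thm 3.11 «obvious»
  for the (3.18)-system built from the embedded cubes, on every Ω₀ ⊇ Ω₁: injective transports isometric on the
  bonds entering Ω₀, positive bond weights, a_c > 0), **`R325_dirichlet_indep_levels`** (Ω₀R↾Ω₀ = Ω₀′R′↾Ω₀′ for it;
  bond weights ≥ 0, Ω₀, Ω₀′ ⊇ Ω₁ + the bonded layer, any (3.25)-data).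

HONEST SCOPE.  Bookkeeping only: which embeddings T_η admits (cubes of side L^j at the printed positions, the torus
structure) is not modelled — ANY injective placement whose intra-cube bonds are bonds of T_η is allowed, exactly as
`B9BlockSystemSigma` allows any bond set ⊇ intra-cube bonds; weights unnormalised (DIVERGENCE D-b09.24); no bound,
no measure; value = the non-vacuity of `B9Eq318DirichletBlocks` on the printed geometry, NOT summit progress.
-/
import Mathlib
import Literature.MathematicalPhysics.QuantumFieldTheory.Balaban1983to89.B9Eq318DirichletBlocks
import Literature.MathematicalPhysics.QuantumFieldTheory.Balaban1983to89.B9BlockSystemSigma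

namespace Literature.MathematicalPhysics.QuantumFieldTheory.Balaban1983to89.B9Eq318EmbeddedLevels

open Finset
open Literature.MathematicalPhysics.QuantumFieldTheory.Balaban1983to89.B9Eq323Ker
  Literature.MathematicalPhysics.QuantumFieldTheory.Balaban1983to89.B9Thm311Lattice
  Literature.MathematicalPhysics.QuantumFieldTheory.Balaban1983to89.B9Eq325Proj
  Literature.MathematicalPhysics.QuantumFieldTheory.Balaban1983to89.B9Eq323DirichletSplit
  Literature.MathematicalPhysics.QuantumFieldTheory.Balaban1983to89.B9Eq318DirichletBlocks
  Literature.MathematicalPhysics.QuantumFieldTheory.Balaban1983to89.B9BlockSystemSigma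
  Literature.MathematicalPhysics.QuantumFieldTheory.Balaban1983to89.B9BlockSystemCubes
open scoped InnerProductSpace

/-! ## §1  Transport of a block system along a bijection of sites -/

section Equiv

variable {X X₂ Y : Type*} (ε : X ≃ X₂)

/-- Transported weights w₂(c, x₂) = w(c, ε⁻¹x₂). [cite: Balaban1985BackgroundPropagators, (3.18)-(3.19) p. 393] -/
def eqvW (w : Y → X → ℝ) : Y → X₂ → ℝ := fun c x₂ => w c (ε.symm x₂)

/-- Transported blocks B₂(c) = ε(B(c)). [cite: Balaban1985BackgroundPropagators, (3.18)-(3.19) p. 393] -/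
def eqvB (B : Y → Finset X) : Y → Finset X₂ := fun c => (B c).map ε.toEmbedding

/-- Transported contours Γ₂(c, x₂) = ε(Γ(c, ε⁻¹x₂)). [cite: Balaban1985BackgroundPropagators, (3.19) p. 393] -/
def eqvΓ (Γ : Y → X → List X) : Y → X₂ → List X₂ := fun c x₂ => (Γ c (ε.symm x₂)).map ε

/-- Transported centres y₂(c) = ε(y(c)). [cite: Balaban1985BackgroundPropagators, (3.18) p. 393] -/
def eqvY (y : Y → X) : Y → X₂ := fun c => ε (y c)

/-- Membership in a transported block. [cite: Balaban1985BackgroundPropagators, (3.18) p. 393] -/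
theorem mem_eqvB (B : Y → Finset X) (c : Y) (x₂ : X₂) : x₂ ∈ eqvB ε B c ↔ ε.symm x₂ ∈ B c := by
  unfold eqvB
  rw [Finset.mem_map_equiv]

/-- **A block system transported along a bijection of sites is a block system**, for every bond set of the target
containing the images of the source bonds. [cite: Balaban1985BackgroundPropagators, (3.18)-(3.19) p. 393] -/
theorem isBlockSystem_equiv {bonds : Finset (X × X)} {bonds₂ : Finset (X₂ × X₂)}
    (hb : ∀ a b : X, (a, b) ∈ bonds → (ε a, ε b) ∈ bonds₂) {w : Y → X → ℝ} {B : Y → Finset X}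
    {Γ : Y → X → List X} {y : Y → X} (hS : IsBlockSystem bonds w B Γ y) :
    IsBlockSystem bonds₂ (eqvW ε w) (eqvB ε B) (eqvΓ ε Γ) (eqvY ε y) where
  chain c x₂ hx₂ := by
    have hx : ε.symm x₂ ∈ B c := (mem_eqvB ε B c x₂).1 hx₂
    have eq : eqvY ε y c :: eqvΓ ε Γ c x₂ = (y c :: Γ c (ε.symm x₂)).map ε := rfl
    rw [eq]
    exact List.isChain_map_of_isChain ε (fun a b h => hb a b h) (hS.chain c _ hx)
  last c x₂ hx₂ := by
    have hx : ε.symm x₂ ∈ B c := (mem_eqvB ε B c x₂).1 hx₂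
    have eq : eqvY ε y c :: eqvΓ ε Γ c x₂ = (y c :: Γ c (ε.symm x₂)).map ε := rfl
    simp only [eq, List.getLast_map, hS.last c _ hx, Equiv.apply_symm_apply]
  sum_ne c := by
    show ∑ x₂ ∈ (B c).map ε.toEmbedding, w c (ε.symm x₂) ≠ 0
    rw [Finset.sum_map]
    simp only [Equiv.coe_toEmbedding, Equiv.symm_apply_apply]
    exact hS.sum_ne c
  cover x₂ := by
    obtain ⟨c, hc⟩ := hS.cover (ε.symm x₂)
    exact ⟨c, (mem_eqvB ε B c x₂).2 hc⟩
  centre_mem c := (mem_eqvB ε B c _).2 (by rw [eqvY, Equiv.symm_apply_apply]; exact hS.centre_mem c)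
  centre_path c := by
    show (Γ c (ε.symm (ε (y c)))).map ε = []
    rw [Equiv.symm_apply_apply, hS.centre_path c, List.map_nil]
  centre_wt c := by
    show w c (ε.symm (ε (y c))) ≠ 0
    rw [Equiv.symm_apply_apply]
    exact hS.centre_wt c
  disj c c' hne hmem := by
    have h : ε.symm (ε (y c')) ∈ B c := (mem_eqvB ε B c _).1 hmem
    rw [Equiv.symm_apply_apply] at h
    exact hS.disj c c' hne h

end Equiv

/-! ## §2  An embedded finite lattice X ↪ T_η as the domain Ω₁ -/

section Embed

variable {X Xt Y : Type*} [Fintype X] [DecidableEq Xt] (emb : X ↪ Xt)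

/-- **Ω₁ := the image of the embedded lattice X in T_η**, as a finite set of sites.
[cite: Balaban1985BackgroundPropagators, (3.18) p. 393] -/
def embΩ : Finset Xt := (univ : Finset X).map emb

omit [DecidableEq Xt] in
/-- The points of X land in Ω₁. [cite: Balaban1985BackgroundPropagators, (3.18) p. 393] -/
theorem emb_mem_embΩ (x : X) : emb x ∈ embΩ emb := Finset.mem_map_of_mem emb (mem_univ x)

omit [DecidableEq Xt] in
/-- Ω₁ is exactly the image of X. [cite: Balaban1985BackgroundPropagators, (3.18) p. 393] -/
theorem mem_embΩ (x' : Xt) : x' ∈ embΩ emb ↔ ∃ x : X, emb x = x' := by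
  unfold embΩ
  rw [Finset.mem_map]
  exact ⟨fun ⟨x, _, hx⟩ => ⟨x, hx⟩, fun ⟨x, hx⟩ => ⟨x, mem_univ x, hx⟩⟩

omit [DecidableEq Xt] in
/-- **X ≃ Ω₁**: the embedding, corestricted to its image. [cite: Balaban1985BackgroundPropagators, (3.18) p. 393] -/
noncomputable def embEquiv : X ≃ ↥(embΩ emb) :=
  Equiv.ofBijective (fun x => ⟨emb x, emb_mem_embΩ emb x⟩)
    ⟨fun a b h => emb.injective (congrArg Subtype.val h), fun z => by
      obtain ⟨x, -, hx⟩ := Finset.mem_map.mp z.2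
      exact ⟨x, Subtype.ext hx⟩⟩

omit [DecidableEq Xt] in
/-- Values of `embEquiv`. [cite: Balaban1985BackgroundPropagators, (3.18) p. 393] -/
theorem coe_embEquiv (x : X) : (embEquiv emb x : Xt) = emb x := rfl

/-- **A block system on X, placed in T_η by emb, is a block system on Ω₁ = emb(X) for the bonds of T_η inside Ω₁**,
provided emb maps the bonds of X (those along which the contours run) to bonds of T_η.
[cite: Balaban1985BackgroundPropagators, (3.18)-(3.19) p. 393] -/
theorem isBlockSystem_embed {bondsX : Finset (X × X)} {bonds : Finset (Xt × Xt)}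
    (hb : ∀ a b : X, (a, b) ∈ bondsX → (emb a, emb b) ∈ bonds) {w : Y → X → ℝ} {B : Y → Finset X}
    {Γ : Y → X → List X} {y : Y → X} (hS : IsBlockSystem bondsX w B Γ y) :
    IsBlockSystem (intBonds (embΩ emb) bonds) (eqvW (embEquiv emb) w) (eqvB (embEquiv emb) B)
      (eqvΓ (embEquiv emb) Γ) (eqvY (embEquiv emb) y) :=
  isBlockSystem_equiv (embEquiv emb) (fun a b h => (mem_intBonds (embΩ emb) bonds _).2 (hb a b h)) hS

end Embed

/-! ## §3  The multi-level cube geometry of (3.18) inside T_η -/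

section Levels

variable {J : Type*} [Fintype J] [DecidableEq J] (d : ℕ) (M l : J → ℕ) {Xt : Type*} [Fintype Xt]
  [DecidableEq Xt] (emb : LSite d M l ↪ Xt) (bonds : Finset (Xt × Xt))

omit [Fintype Xt] in
/-- **The printed Ω₁-blocks**: the multi-level cube geometry (level j: M_j^d cubes of side l_j + 1, weights, axial
contours, centres of `B9BlockSystemCubes`/`B9BlockSystemSigma`) placed in T_η by an embedding that maps intra-cube
bonds to bonds of T_η is a block system on Ω₁ = its image, for the bonds of T_η inside Ω₁.
[cite: Balaban1985BackgroundPropagators, (3.18)-(3.19) p. 393; Balaban1985Averaging, (2)-(3) p. 17] -/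
theorem isBlockSystem_levels_embed
    (hb : ∀ a b, (a, b) ∈ sigBonds (fun j => bondsC d (M j) (l j)) → (emb a, emb b) ∈ bonds) :
    IsBlockSystem (intBonds (embΩ emb) bonds) (eqvW (embEquiv emb) (sigW fun j => wtC d (M j) (l j)))
      (eqvB (embEquiv emb) (sigB fun j => blockC d (M j) (l j)))
      (eqvΓ (embEquiv emb) (sigΓ fun j => pathC d (M j) (l j)))
      (eqvY (embEquiv emb) (sigY fun j => centreC d (M j) (l j))) :=
  isBlockSystem_embed emb hb (isBlockSystem_levels d M l _ subset_rfl)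

variable {V : Type*} [NormedAddCommGroup V] [InnerProductSpace ℝ V] [FiniteDimensional ℝ V]
  (τ : Xt → Xt → V →ₗ[ℝ] V) (cb : Xt × Xt → ℝ)

/-- **Thm 3.11 «obvious for the first three operators» for the (3.18)-system of the embedded multi-level cube
geometry**, on every Ω₀ ⊇ Ω₁: the (3.25)-data of the Dirichlet operator Ω₀Δ_TΩ₀ with the constructed Q′ (`qS` of the
transported cubes) EXIST — injective transports isometric on the bonds entering Ω₀, positive bond weights, a_c > 0,
intra-cube bonds ⊆ bonds of T_η; no further hypothesis.
[cite: Balaban1985BackgroundPropagators, Thm 3.11 p. 416, (3.18) p. 393, (3.23)-(3.25) p. 394] -/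
theorem exists_data_levels
    (hb : ∀ a b, (a, b) ∈ sigBonds (fun j => bondsC d (M j) (l j)) → (emb a, emb b) ∈ bonds)
    (S : Finset Xt) (hΩ : embΩ emb ⊆ S) (hinj : ∀ x x' : Xt, Function.Injective (τ x x'))
    (hcb : ∀ b ∈ bonds, 0 < cb b)
    (hiso : ∀ b ∈ bonds, b.1 ∉ S → b.2 ∈ S → ∀ u v : V, ⟪τ b.1 b.2 u, τ b.1 b.2 v⟫_ℝ = ⟪u, v⟫_ℝ)
    (a : LCentre d M ⊕ {x : ↥S // (x : Xt) ∉ embΩ emb} → ℝ) (ha : ∀ c, 0 < a c) :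
    ∃ (g : PiLp 2 (fun _ : ↥S => V) →ₗ[ℝ] PiLp 2 (fun _ : ↥S => V))
      (cc : PiLp 2 (fun _ : LCentre d M ⊕ {x : ↥S // (x : Xt) ∉ embΩ emb} => V) →ₗ[ℝ]
        PiLp 2 (fun _ : LCentre d M ⊕ {x : ↥S // (x : Xt) ∉ embΩ emb} => V)),
      Data (resS S ∘ₗ lapL τ bonds cb ∘ₗ extS S)
        (qS (embΩ emb) S hΩ τ (eqvW (embEquiv emb) (sigW fun j => wtC d (M j) (l j)))
          (eqvB (embEquiv emb) (sigB fun j => blockC d (M j) (l j)))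
          (eqvΓ (embEquiv emb) (sigΓ fun j => pathC d (M j) (l j)))
          (eqvY (embEquiv emb) (sigY fun j => centreC d (M j) (l j))))
        (LinearMap.adjoint (qS (embΩ emb) S hΩ τ (eqvW (embEquiv emb) (sigW fun j => wtC d (M j) (l j)))
          (eqvB (embEquiv emb) (sigB fun j => blockC d (M j) (l j)))
          (eqvΓ (embEquiv emb) (sigΓ fun j => pathC d (M j) (l j)))
          (eqvY (embEquiv emb) (sigY fun j => centreC d (M j) (l j))))) (AL a) g cc :=
  exists_data_qS (embΩ emb) τ bonds cb _ _ _ _ S hΩ hinj hcb hiso (isBlockSystem_levels_embed d M l emb bonds hb)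
    a ha

/-- **R does not depend on Ω₀, for the (3.18)-system of the embedded multi-level cube geometry** — a direct
specialisation of `B9Eq318DirichletBlocks.R325_dirichlet_indep` (which needs no structural hypothesis on the
Ω₁-blocks at all): bond weights ≥ 0, Ω₀ = S₁ and Ω₀′ = S₂ ⊇ Ω₁ together with every site bonded to Ω₁, any
(3.25)-data on each. [cite: Balaban1985BackgroundPropagators, (3.18) p. 393, (3.21)+(3.23)+(3.25) p. 394] -/
theorem R325_dirichlet_indep_levels (hcb : ∀ b ∈ bonds, 0 ≤ cb b) (S₁ S₂ : Finset Xt) (hΩ₁ : embΩ emb ⊆ S₁)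
    (hΩ₂ : embΩ emb ⊆ S₂)
    (hlayer₁ : ∀ b ∈ bonds, (b.1 ∈ embΩ emb → b.2 ∈ S₁) ∧ (b.2 ∈ embΩ emb → b.1 ∈ S₁))
    (hlayer₂ : ∀ b ∈ bonds, (b.1 ∈ embΩ emb → b.2 ∈ S₂) ∧ (b.2 ∈ embΩ emb → b.1 ∈ S₂))
    {qs₁ : PiLp 2 (fun _ : LCentre d M ⊕ {x : ↥S₁ // (x : Xt) ∉ embΩ emb} => V) →ₗ[ℝ] PiLp 2 (fun _ : ↥S₁ => V)}
    {A₁ c₁ : PiLp 2 (fun _ : LCentre d M ⊕ {x : ↥S₁ // (x : Xt) ∉ embΩ emb} => V) →ₗ[ℝ]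
      PiLp 2 (fun _ : LCentre d M ⊕ {x : ↥S₁ // (x : Xt) ∉ embΩ emb} => V)}
    {g₁ : PiLp 2 (fun _ : ↥S₁ => V) →ₗ[ℝ] PiLp 2 (fun _ : ↥S₁ => V)}
    {qs₂ : PiLp 2 (fun _ : LCentre d M ⊕ {x : ↥S₂ // (x : Xt) ∉ embΩ emb} => V) →ₗ[ℝ] PiLp 2 (fun _ : ↥S₂ => V)}
    {A₂ c₂ : PiLp 2 (fun _ : LCentre d M ⊕ {x : ↥S₂ // (x : Xt) ∉ embΩ emb} => V) →ₗ[ℝ]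
      PiLp 2 (fun _ : LCentre d M ⊕ {x : ↥S₂ // (x : Xt) ∉ embΩ emb} => V)}
    {g₂ : PiLp 2 (fun _ : ↥S₂ => V) →ₗ[ℝ] PiLp 2 (fun _ : ↥S₂ => V)}
    (h₁ : Data (resS S₁ ∘ₗ lapL τ bonds cb ∘ₗ extS S₁)
      (qS (embΩ emb) S₁ hΩ₁ τ (eqvW (embEquiv emb) (sigW fun j => wtC d (M j) (l j)))
        (eqvB (embEquiv emb) (sigB fun j => blockC d (M j) (l j)))
        (eqvΓ (embEquiv emb) (sigΓ fun j => pathC d (M j) (l j)))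
        (eqvY (embEquiv emb) (sigY fun j => centreC d (M j) (l j)))) qs₁ A₁ g₁ c₁)
    (h₂ : Data (resS S₂ ∘ₗ lapL τ bonds cb ∘ₗ extS S₂)
      (qS (embΩ emb) S₂ hΩ₂ τ (eqvW (embEquiv emb) (sigW fun j => wtC d (M j) (l j)))
        (eqvB (embEquiv emb) (sigB fun j => blockC d (M j) (l j)))
        (eqvΓ (embEquiv emb) (sigΓ fun j => pathC d (M j) (l j)))
        (eqvY (embEquiv emb) (sigY fun j => centreC d (M j) (l j)))) qs₂ A₂ g₂ c₂) :
    extS S₁ ∘ₗ R325 (qS (embΩ emb) S₁ hΩ₁ τ (eqvW (embEquiv emb) (sigW fun j => wtC d (M j) (l j)))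
        (eqvB (embEquiv emb) (sigB fun j => blockC d (M j) (l j)))
        (eqvΓ (embEquiv emb) (sigΓ fun j => pathC d (M j) (l j)))
        (eqvY (embEquiv emb) (sigY fun j => centreC d (M j) (l j)))) qs₁ g₁ c₁ ∘ₗ resS S₁
      = extS S₂ ∘ₗ R325 (qS (embΩ emb) S₂ hΩ₂ τ (eqvW (embEquiv emb) (sigW fun j => wtC d (M j) (l j)))
        (eqvB (embEquiv emb) (sigB fun j => blockC d (M j) (l j)))
        (eqvΓ (embEquiv emb) (sigΓ fun j => pathC d (M j) (l j)))
        (eqvY (embEquiv emb) (sigY fun j => centreC d (M j) (l j)))) qs₂ g₂ c₂ ∘ₗ resS S₂ :=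
  R325_dirichlet_indep (embΩ emb) τ bonds cb _ _ _ _ hcb S₁ S₂ hΩ₁ hΩ₂ hlayer₁ hlayer₂ h₁ h₂

end Levels

end Literature.MathematicalPhysics.QuantumFieldTheory.Balaban1983to89.B9Eq318EmbeddedLevels
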